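import Literature.Computability.AlgebraicComplexity.DIP20MultiplicityObstructions
import Literature.Computability.Complexity.OccurrenceObstructionsIPExceptional
import Literature.RepresentationTheory.GeneralLinear.PlethysmWordModel
import HarnessLib

/-!
# Dörfler–Ikenmeyer–Panova 2019, Lemmas 3.7 and 3.13: the hook-like exceptional tails give vanishing
# plethysm coefficients (the part of the two lemmas covered by the tree's block-swap cancellation)

Topic `Literature/Computability/AlgebraicComplexity`; sibling proofs file (D-0014) of
`DIP20MultiplicityObstructions.lean` (named facts `DIP20_lem_3_7`, `DIP20_lem_3_13`; row vocabulary
`rowDual`, tails `dipTails36`, `dipTails47`). Theorems only, no new facts.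

J. Dörfler, C. Ikenmeyer, G. Panova, SIAM J. Appl. Algebra Geom. 4 (2020) = arXiv:1901.04576:
* Lemma 3.7 (arXiv p. 5): "If `λ` is an `m`-partition of `dn` and `λ̄ ∈ {(3,3),(3,1),(2,1),(1,1),(1)}`,
  then `a_λ(d[n]) = 0`" ("proved by a finite calculation for all cases but `(3,3)` as Thm 1.10(a) in
  [IP17]. Exactly the same calculation can be used to also prove the result for `(3,3)`").
* Lemma 3.13 (arXiv p. 7): the same for 4-partitions with `λ̄ ∈ Y` (18 bodies), "proven exactly like
  Lemma 3.7".

The tree proves Ikenmeyer–Panova's Thm. 1.7(a) DIRECTLY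
(`Literature/Computability/AlgebraicComplexity/PlethysmHookVanishing.lean`,
`eq_zero_of_mem_highestWeightSpace_coordRep_of_shape`: no plethysm highest-weight vector of a
*hook-like* weight — cells outside column `0` in rows `≤ 1`, `ℓ(λ) ≥ 2`, `λ₂ ≤ ℓ(λ)`, and `λ₂ ≤ 1` or
`ℓ(λ) ≥ 3` — by a block-swap cancellation of wreath-symmetrised polytabloids). This file reads off the
part of DIP's two lemmas covered by that theorem, for every inner degree `n` and in DIP's row
vocabulary:

* `plethysmCoeff_rowDual_eq_zero_of_hookLike` — the general statement for a row vector
  `μ = (a, L…, 0…)` with hook-like lower rows `L`;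
* **`DIP20_lem_3_7_of_ne_33`** — Lemma 3.7 for the four tails `(3,1), (2,1), (1,1), (1)` (i.e. all but
  `(3,3)`): these are IP's bodies `𝔛 ∩ {ℓ ≤ 2}`;
* **`DIP20_lem_3_13_of_hookLike`** — Lemma 3.13 for the eight tails `(1), (1,1), (1,1,1), (2,1), (2,1,1),
  (3,1), (3,1,1), (4,1,1)` of `Y`.

NOT covered (the shape hypothesis "cells outside column `0` in rows `≤ 1`" or "`λ₂ ≤ ℓ(λ)`" fails):
the tail `(3,3)` of Lemma 3.7 and the ten tails `(2,2,1), (3,2,1), (3,3), (3,3,1), (3,3,2), (3,3,3),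
(4,3,3), (5,1,1), (5,5,5), (6,1,1)` of `Y`; for these DIP's route (IP's finite calculation of limit
coefficients + IP Prop. 2.8) or a new cancellation is needed, so `DIP20_lem_3_7` and `DIP20_lem_3_13`
stay named facts.

## References

* J. Dörfler, C. Ikenmeyer, G. Panova, SIAM J. Appl. Algebra Geom. 4 (2020) = arXiv:1901.04576, Lemma 3.7
  (arXiv p. 5; TeX `multobs.tex` L397 `{lem:vanishingpleth}`), Lemma 3.13 (arXiv p. 7; L480
  `{lem:vanishingpleth74}`). [key `DorflerIkenmeyerPanova2020`]
* C. Ikenmeyer, G. Panova, Adv. Math. 319 (2017) = arXiv:1512.03798, Thm. 1.7(a). [key `IkenmeyerPanova2017`]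
* W. Fulton, *Young Tableaux*, LMS Student Texts 35 (1997), §0 (partitions). [key `FultonYoungTableaux1997`]

## Mathlib and tree

Tree: `eq_zero_of_mem_highestWeightSpace_coordRep_of_shape` (`PlethysmHookVanishing`),
`Complexity.shape_of_sortedParts` (`OccurrenceObstructionsIPExceptional`), `strictAnti_revPerm`,
`neg_dualOfPartition_rev` (`PlethysmWordModel`), `monWeight_eq_of_mem_weightSpace`, `size_monWeight`,
`isHomogeneous_of_mem_highestWeightSpace`, `Weight.size_ofPartition_holds`, `rowDual`
(`DIP20MultiplicityObstructions`). Mathlib: `List.mergeSort_eq_self`, `Multiset.coe_sort`.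
-/

open MvPolynomial

namespace Literature.Computability.AlgebraicComplexity

open _root_.Literature.NumberTheory.DiophantineGeometry
open _root_.Literature.RepresentationTheory.GeneralLinear (strictAnti_revPerm neg_dualOfPartition_rev)

/-! ### Partitions from decreasing lists -/

section DescList

/-- The partition with a given list of positive parts (a partition "is a weakly decreasing sequence of
positive integers", read here from any list of positive parts). [cite: FultonYoungTableaux1997, §0 (Notation: partitions)] -/
def partitionOfList (l : List ℕ) (hpos : ∀ x ∈ l, 0 < x) : Nat.Partition l.sum :=
  ⟨(l : Multiset ℕ), fun hx => hpos _ (Multiset.mem_coe.mp hx), Multiset.sum_coe l⟩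

/-- Its number of parts is the length of the list. [cite: FultonYoungTableaux1997, §0 (Notation: partitions)] -/
theorem card_parts_partitionOfList (l : List ℕ) (hpos : ∀ x ∈ l, 0 < x) :
    (partitionOfList l hpos).parts.card = l.length :=
  Multiset.coe_card l

/-- For a weakly decreasing list, the sorted parts are the list itself. [cite: FultonYoungTableaux1997, §0 (Notation: partitions as weakly decreasing sequences)] -/
theorem sortedParts_partitionOfList (l : List ℕ) (hpos : ∀ x ∈ l, 0 < x)
    (hsorted : l.Pairwise (· ≥ ·)) : (partitionOfList l hpos).sortedParts = l := by
  change (l : Multiset ℕ).sort (· ≥ ·) = l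
  rw [Multiset.coe_sort]
  exact List.mergeSort_eq_self _ hsorted

end DescList

/-! ### Hook-like row vectors carry no plethysm highest-weight vectors -/

section HookLike

/-- **No plethysm highest-weight vector of hook-like type, row form.** Let `μ : Fin N → ℕ` be the
row vector `(a, L₀, L₁, …)` padded with zeros, where `a ≥ L₀ ≥ L₁ ≥ ⋯ > 0`, `|L| + 1 ≤ N`, `|L| ≥ 1`,
`L₁ ≤ 1`, `L₀ ≤ |L| + 1`, and `L₀ ≤ 1` or `|L| ≥ 2` (the hooks `(a, 1^j)` and the near-hooks
`(a, r, 1^j)` with `r ≤ j + 2`). Then `a_μ(d[n]) = plethysmCoeff ℂ (Fin N) n μ^* = 0` for EVERY `n`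
(for `n ∣ |μ|` by `eq_zero_of_mem_highestWeightSpace_coordRep_of_shape` in degree `|μ|/n`; otherwise,
and for `n = 0`, the weight space is already `0`, a weight pinning the degree).
[cite: DorflerIkenmeyerPanova2020, Lemma 3.7 / Lemma 3.13 (arXiv pp. 5, 7; the hook-like tails) via IkenmeyerPanova2017 Thm. 1.7(a)] -/
theorem plethysmCoeff_rowDual_eq_zero_of_hookLike {N : ℕ} (a : ℕ) (L : List ℕ)
    (hpos : ∀ x ∈ a :: L, 0 < x) (hsorted : (a :: L).Pairwise (· ≥ ·)) (hN : L.length + 1 ≤ N)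
    (hL1 : L.getD 1 0 ≤ 1) (hlen : 1 ≤ L.length) (hL0 : L.getD 0 0 ≤ L.length + 1)
    (hL0' : L.getD 0 0 ≤ 1 ∨ 2 ≤ L.length) (μ : Fin N → ℕ)
    (hμ : ∀ i : Fin N, μ i = (a :: L).getD i 0) (n : ℕ) :
    plethysmCoeff ℂ (Fin N) n (rowDual μ) = 0 := by
  classical
  haveI : Infinite ℂ := CharZero.infinite ℂ
  set lam := partitionOfList (a :: L) hpos with hlamdef
  have hs : lam.sortedParts = a :: L := sortedParts_partitionOfList _ hpos hsorted
  have hcard : lam.parts.card = L.length + 1 := by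
    rw [hlamdef, card_parts_partitionOfList, List.length_cons]
  have hlamN : lam.parts.card ≤ N := hcard ▸ hN
  obtain ⟨h1, h2, h3, h4⟩ := Complexity.shape_of_sortedParts lam hs hcard hL1 hlen hL0 hL0'
  have hχ : rowDual μ = Weight.dualOfPartition N lam := by
    have hfun : μ = fun i : Fin N => lam.sortedParts.getD i 0 := funext fun i => by rw [hμ, hs]
    rw [hfun]
    rfl
  rw [hχ, plethysmCoeff, hwMultiplicity]
  suffices H : highestWeightSpace (coordRep (Fin N) ℂ n) (Weight.dualOfPartition N lam) = ⊥ by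
    rw [H, finrank_bot]
  rw [Submodule.eq_bot_iff]
  intro h hh
  by_contra hne
  obtain ⟨s, hsup⟩ := support_nonempty.mpr hne
  have hw := monWeight_eq_of_mem_weightSpace (highestWeightSpace_le_weightSpace _ _ hh) hsup
  have hsize1 := size_monWeight s
  rw [hw, Weight.dualOfPartition, Weight.size_dual, Weight.size_ofPartition_holds hlamN, neg_inj,
    Nat.cast_inj] at hsize1
  -- `|μ| = n · deg s`, so `n ≠ 0` and `h` is a form of degree `deg s`
  have hsumpos : 0 < (a :: L).sum := by
    rw [List.sum_cons]
    have := hpos a (by simp)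
    omega
  have hn : n ≠ 0 := by
    rintro rfl
    rw [Nat.zero_mul] at hsize1
    omega
  let lam' : Nat.Partition (s.degree * n) :=
    ⟨lam.parts, lam.parts_pos, by rw [lam.parts_sum, hsize1, Nat.mul_comm]⟩
  have hw' : Weight.dualOfPartition N lam' = Weight.dualOfPartition N lam := rfl
  rw [← hw'] at hh
  have hhom : h.IsHomogeneous s.degree := by
    refine isHomogeneous_of_mem_highestWeightSpace hn hh ?_
    rw [Weight.dualOfPartition, Weight.size_dual, Weight.size_ofPartition_holds (μ := lam') hlamN,
      Nat.mul_comm]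
  exact hne (eq_zero_of_mem_highestWeightSpace_coordRep_of_shape strictAnti_revPerm lam' hlamN h1 h2
    h3 h4 hhom (fun i => congrFun (neg_dualOfPartition_rev (N := N) lam') i) hh)

end HookLike

/-! ### Lemma 3.7: the four IP tails -/

section Lemma37

/-- **Lemma 3.7 for the tails `(3,1), (2,1), (1,1), (1)`** (all printed tails but `(3,3)`): for a
3-partition `μ` with `μ̄` one of these, `a_μ(d[n]) = 0` for every `n` — IP's Thm. 1.7(a) bodies
`(1), (1,1), (2,1), (3,1)`, here through the tree's direct proof for hook-like shapes. The tail `(3,3)`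
("exactly the same calculation", loc. cit.) is not hook-like and is not covered.
[cite: DorflerIkenmeyerPanova2020, Lemma 3.7 (arXiv p. 5; TeX multobs.tex L397 {lem:vanishingpleth}; held paper-arxiv-1901.04576 p0006.txt:L105 "Lemma 7")] -/
theorem DIP20_lem_3_7_of_ne_33 (n : ℕ) (μ : Fin 3 → ℕ) (hμ : Antitone μ)
    (ht : (μ 1, μ 2) ∈ dipTails36) (h33 : (μ 1, μ 2) ≠ (3, 3)) :
    plethysmCoeff ℂ (Fin 3) n (rowDual μ) = 0 := by
  have h10 : μ 1 ≤ μ 0 := hμ (show (0 : Fin 3) ≤ 1 by decide)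
  simp only [dipTails36, Finset.mem_insert, Finset.mem_singleton, Prod.mk.injEq] at ht
  rcases ht with ⟨hb, hc⟩ | ⟨hb, hc⟩ | ⟨hb, hc⟩ | ⟨hb, hc⟩ | ⟨hb, hc⟩
  · exact absurd (show (μ 1, μ 2) = (3, 3) by rw [hb, hc]) h33
  · -- tail `(3,1)`
    refine plethysmCoeff_rowDual_eq_zero_of_hookLike (μ 0) [3, 1] ?_ ?_ (by simp) (by simp) (by simp)
      (by simp) (by simp) μ ?_ n
    · intro x hx; simp at hx; omega
    · simp; omega
    · intro i; fin_cases i <;> simp [hb, hc]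
  · -- tail `(2,1)`
    refine plethysmCoeff_rowDual_eq_zero_of_hookLike (μ 0) [2, 1] ?_ ?_ (by simp) (by simp) (by simp)
      (by simp) (by simp) μ ?_ n
    · intro x hx; simp at hx; omega
    · simp; omega
    · intro i; fin_cases i <;> simp [hb, hc]
  · -- tail `(1,1)`
    refine plethysmCoeff_rowDual_eq_zero_of_hookLike (μ 0) [1, 1] ?_ ?_ (by simp) (by simp) (by simp)
      (by simp) (by simp) μ ?_ n
    · intro x hx; simp at hx; omega
    · simp; omega
    · intro i; fin_cases i <;> simp [hb, hc]
  · -- tail `(1)`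
    refine plethysmCoeff_rowDual_eq_zero_of_hookLike (μ 0) [1] ?_ ?_ (by simp) (by simp) (by simp)
      (by simp) (by simp) μ ?_ n
    · intro x hx; simp at hx; omega
    · simp; omega
    · intro i; fin_cases i <;> simp [hb, hc]

end Lemma37

/-! ### Lemma 3.13: the eight hook-like tails of `Y` -/

section Lemma313

/-- **Lemma 3.13 for the hook-like tails of `Y`**: for a 4-partition `μ` with
`μ̄ ∈ {(1), (1,1), (1,1,1), (2,1), (2,1,1), (3,1), (3,1,1), (4,1,1)}`, `a_μ(d[n]) = 0` for every `n`.
The other ten bodies of `Y` are not hook-like and are not covered.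
[cite: DorflerIkenmeyerPanova2020, Lemma 3.13 (arXiv p. 7; TeX multobs.tex L480 {lem:vanishingpleth74}; held paper-arxiv-1901.04576 p0007.txt:L71 "Lemma 11")] -/
theorem DIP20_lem_3_13_of_hookLike (n : ℕ) (μ : Fin 4 → ℕ) (hμ : Antitone μ)
    (ht : (μ 1, μ 2, μ 3) ∈ ({(1, 0, 0), (1, 1, 0), (1, 1, 1), (2, 1, 0), (2, 1, 1), (3, 1, 0), (3, 1, 1),
      (4, 1, 1)} : Finset (ℕ × ℕ × ℕ))) :
    plethysmCoeff ℂ (Fin 4) n (rowDual μ) = 0 := by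
  have h10 : μ 1 ≤ μ 0 := hμ (show (0 : Fin 4) ≤ 1 by decide)
  simp only [Finset.mem_insert, Finset.mem_singleton, Prod.mk.injEq] at ht
  rcases ht with ⟨hb, hc, he⟩ | ⟨hb, hc, he⟩ | ⟨hb, hc, he⟩ | ⟨hb, hc, he⟩ | ⟨hb, hc, he⟩ |
    ⟨hb, hc, he⟩ | ⟨hb, hc, he⟩ | ⟨hb, hc, he⟩
  · refine plethysmCoeff_rowDual_eq_zero_of_hookLike (μ 0) [1] ?_ ?_ (by simp) (by simp) (by simp)
      (by simp) (by simp) μ ?_ n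
    · intro x hx; simp at hx; omega
    · simp; omega
    · intro i; fin_cases i <;> simp [hb, hc, he]
  · refine plethysmCoeff_rowDual_eq_zero_of_hookLike (μ 0) [1, 1] ?_ ?_ (by simp) (by simp) (by simp)
      (by simp) (by simp) μ ?_ n
    · intro x hx; simp at hx; omega
    · simp; omega
    · intro i; fin_cases i <;> simp [hb, hc, he]
  · refine plethysmCoeff_rowDual_eq_zero_of_hookLike (μ 0) [1, 1, 1] ?_ ?_ (by simp) (by simp) (by simp)
      (by simp) (by simp) μ ?_ n
    · intro x hx; simp at hx; omega
    · simp; omega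
    · intro i; fin_cases i <;> simp [hb, hc, he]
  · refine plethysmCoeff_rowDual_eq_zero_of_hookLike (μ 0) [2, 1] ?_ ?_ (by simp) (by simp) (by simp)
      (by simp) (by simp) μ ?_ n
    · intro x hx; simp at hx; omega
    · simp; omega
    · intro i; fin_cases i <;> simp [hb, hc, he]
  · refine plethysmCoeff_rowDual_eq_zero_of_hookLike (μ 0) [2, 1, 1] ?_ ?_ (by simp) (by simp) (by simp)
      (by simp) (by simp) μ ?_ n
    · intro x hx; simp at hx; omega
    · simp; omega
    · intro i; fin_cases i <;> simp [hb, hc, he]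
  · refine plethysmCoeff_rowDual_eq_zero_of_hookLike (μ 0) [3, 1] ?_ ?_ (by simp) (by simp) (by simp)
      (by simp) (by simp) μ ?_ n
    · intro x hx; simp at hx; omega
    · simp; omega
    · intro i; fin_cases i <;> simp [hb, hc, he]
  · refine plethysmCoeff_rowDual_eq_zero_of_hookLike (μ 0) [3, 1, 1] ?_ ?_ (by simp) (by simp) (by simp)
      (by simp) (by simp) μ ?_ n
    · intro x hx; simp at hx; omega
    · simp; omega
    · intro i; fin_cases i <;> simp [hb, hc, he]
  · refine plethysmCoeff_rowDual_eq_zero_of_hookLike (μ 0) [4, 1, 1] ?_ ?_ (by simp) (by simp) (by simp)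
      (by simp) (by simp) μ ?_ n
    · intro x hx; simp at hx; omega
    · simp; omega
    · intro i; fin_cases i <;> simp [hb, hc, he]

/-- The eight hook-like tails are bodies of `Y`. [cite: DorflerIkenmeyerPanova2020, Lemma 3.13 (the set Y, arXiv p. 7)] -/
theorem hookLikeTails47_subset_dipTails47 :
    ({(1, 0, 0), (1, 1, 0), (1, 1, 1), (2, 1, 0), (2, 1, 1), (3, 1, 0), (3, 1, 1), (4, 1, 1)} :
      Finset (ℕ × ℕ × ℕ)) ⊆ dipTails47 := by
  decide

end Lemma313

end Literature.Computability.AlgebraicComplexity
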